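import Summits.Ventures.HodgeRepro2.T5BergmanModelEquiv
import Summits.Ventures.HodgeRepro2.T5BergmanMatrixCoeff
import Summits.Ventures.HodgeRepro2.T5Sl2LowestWeightUnitary

/-!
# The Bergman pairing on the `K`-finite vectors IS the invariant form of the abstract module

`T5BergmanModelEquiv` identifies the `K`-finite vectors of the explicit weight-`k` model (the
polynomials `ofCoeffs a = Σ aₙ zⁿ`) with the abstract lowest-weight `𝔰𝔩₂`-module `Model ℂ k` through
the linear isomorphism `D` (`D (single n c) = single n (c λₙ)`, `λₙ = 1/∏_{j<n}(k+j)`), intertwining the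
ladder operators. `T5Sl2LowestWeightUnitary.form μ v w = Σₙ conj(vₙ) wₙ cₙ`, `cₙ = ∏_{j<n} (j+1)(μ+j)`,
is the invariant inner product of the abstract module (`μ = k`). This file proves that the two
inner products agree up to the constant `⟨1, 1⟩_k = π/(k-1)`:

  `⟨ofCoeffs a, ofCoeffs b⟩_k = π/(k-1) · form k (D b) (D a)`   (`pairing_ofCoeffs`)

(the Bergman pairing is linear in the FIRST slot, `form` in the SECOND — hence the swap), i.e. `D` is a
UNITARY identification of the `K`-finite part of the explicit model with the abstract unitary
lowest-weight module, up to the normalisation of the lowest-weight vector. The computation is the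
pairing of two polynomials (`pairing_partialSum_partialSum`: `Σ aₘ conj(bₘ) ⟨zᵐ, zᵐ⟩_k`, from the
orthogonality of the monomials) and the scalar identity `λₙ² cₙ = n!(k-1)!/(n+k-1)! = 1/C(n+k-1, n)`
(`choose_mul_normCoeff`), against `T5BergmanKernel.choose_mul_monomialNormSq`.

Blind lane: Mathlib + the HodgeRepro2 prefix only; no sorry; axioms ⊆ {propext, Classical.choice,
Quot.sound}.
-/

namespace Summit.Ventures.HodgeRepro2.T5BergmanModelUnitary

open MeasureTheory Metric Finsupp
open T5SU11Unimodular T5BergmanCoefficient T5BergmanPairing T5BergmanUnitary T5BergmanFourier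
  T5BergmanKernel T5BergmanParseval T5BergmanProjection T5BergmanCoefficientL2 T5BergmanMatrixCoeff
  T5BergmanModelEquiv T5Sl2LowestWeightUnitary
open scoped Real Nat

/-! ### The scalar identity `λₙ² cₙ = 1/C(n+k-1, n)` -/

/-- `λₙ` is the real number `1/∏_{j<n}(k+j)`. -/
lemma lam_eq_ofReal (k n : ℕ) :
    lam k n = (((∏ j ∈ Finset.range n, ((k : ℝ) + j))⁻¹ : ℝ) : ℂ) := by
  unfold lam
  push_cast
  rfl

/-- `cₙ = n! ∏_{j<n}(k+j)`. -/
lemma normCoeff_eq (k n : ℕ) :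
    normCoeff (k : ℝ) n = (n ! : ℝ) * ∏ j ∈ Finset.range n, ((k : ℝ) + j) := by
  unfold normCoeff
  rw [Finset.prod_mul_distrib]
  congr 1
  rw [← Finset.prod_range_add_one_eq_factorial]
  push_cast
  rfl

/-- **`C(n+k-1, n) · cₙ = (∏_{j<n}(k+j))²`** for `k ≥ 1`. -/
lemma choose_mul_normCoeff (k : ℕ) (hk : 1 ≤ k) (n : ℕ) :
    (((n + k - 1).choose n : ℕ) : ℝ) * normCoeff (k : ℝ) n =
      (∏ j ∈ Finset.range n, ((k : ℝ) + j)) ^ 2 := by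
  induction n with
  | zero => simp [normCoeff_zero]
  | succ n ih =>
    rw [normCoeff_succ, Finset.prod_range_succ, mul_pow, ← ih]
    have h := Nat.add_one_mul_choose_eq (n + k - 1) n
    have e1 : n + k - 1 + 1 = n + k := by omega
    have e2 : n + 1 + k - 1 = n + k := by omega
    simp only [e1] at h
    rw [e2]
    have h' : ((n + k : ℕ) : ℝ) * ((n + k - 1).choose n : ℕ) =
        ((n + k).choose (n + 1) : ℕ) * ((n + 1 : ℕ) : ℝ) := by
      exact_mod_cast h
    push_cast at h' ⊢
    linear_combination (-(normCoeff (k : ℝ) n * ((k : ℝ) + n))) * h'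

/-- `λₙ conj(λₙ) cₙ = (k-1)/π · ⟨zⁿ, zⁿ⟩_k` for `k ≥ 2`. -/
lemma lam_mul_conj_mul_normCoeff (k : ℕ) (hk : 2 ≤ k) (n : ℕ) :
    lam k n * (starRingEnd ℂ) (lam k n) * ((normCoeff (k : ℝ) n : ℝ) : ℂ) =
      ((((k : ℝ) - 1) / π : ℝ) : ℂ) * ((monomialNormSq k n : ℝ) : ℂ) := by
  set P : ℝ := ∏ j ∈ Finset.range n, ((k : ℝ) + j) with hP
  set C : ℝ := (((n + k - 1).choose n : ℕ) : ℝ) with hC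
  set M : ℝ := monomialNormSq k n with hM
  have hk1 : (0 : ℝ) < (k : ℝ) - 1 := by
    have : (2 : ℝ) ≤ k := by exact_mod_cast hk
    linarith
  have hCpos : 0 < C := by
    rw [hC]
    exact_mod_cast Nat.choose_pos (show n ≤ n + k - 1 by omega)
  have hnc : 0 < normCoeff (k : ℝ) n := normCoeff_pos (k : ℝ) (by positivity) n
  have hPpos : 0 < P := Finset.prod_pos fun j _ => by positivity
  have h1 : C * normCoeff (k : ℝ) n = P ^ 2 := choose_mul_normCoeff k (by omega) n
  have h2 : C * M = π / ((k : ℝ) - 1) := choose_mul_monomialNormSq k hk n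
  have hπ : (0 : ℝ) < π := Real.pi_pos
  have e1 : P⁻¹ * P⁻¹ * normCoeff (k : ℝ) n = 1 / C := by
    rw [← mul_inv, ← sq, ← h1]
    field_simp
  have h2' : C * M * ((k : ℝ) - 1) = π := by
    rw [eq_div_iff hk1.ne'] at h2
    exact h2
  have e2 : ((k : ℝ) - 1) / π * M = 1 / C := by
    rw [div_mul_eq_mul_div, div_eq_div_iff hπ.ne' hCpos.ne', one_mul]
    linear_combination h2'
  rw [lam_eq_ofReal, Complex.conj_ofReal, ← hP, ← Complex.ofReal_mul, ← Complex.ofReal_mul, e1,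
    ← Complex.ofReal_mul, e2]

/-! ### `D` and `ofCoeffs` pointwise -/

/-- `(D b)ₘ = bₘ λₘ`. -/
lemma D_apply (k : ℕ) (b : ℕ →₀ ℂ) (m : ℕ) : D k b m = b m * lam k m := by
  unfold D
  rw [Finsupp.lsum_apply, Finsupp.sum, Finsupp.finsetSum_apply]
  simp only [LinearMap.toSpanSingleton_apply, Finsupp.smul_apply, Finsupp.single_apply, smul_eq_mul]
  by_cases hm : m ∈ b.support
  · rw [Finset.sum_eq_single m]
    · simp
    · intro n _ hnm
      simp [hnm]
    · intro h
      exact absurd hm h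
  · have hb : b m = 0 := by
      by_contra h
      exact hm (Finsupp.mem_support_iff.mpr h)
    rw [hb, zero_mul]
    refine Finset.sum_eq_zero fun n hn => ?_
    have hnm : n ≠ m := fun h => hm (h ▸ hn)
    simp [hnm]

/-- The support of `D b` is contained in the support of `b`. -/
lemma support_D_subset (k : ℕ) (b : ℕ →₀ ℂ) : (D k b).support ⊆ b.support := by
  intro m hm
  rw [Finsupp.mem_support_iff, D_apply] at hm
  exact Finsupp.mem_support_iff.mpr (left_ne_zero_of_mul hm)

/-- A polynomial with coefficients supported in `range N` is the `N`-th partial sum. -/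
lemma ofCoeffs_eq_partialSum (a : ℕ →₀ ℂ) {N : ℕ} (hN : a.support ⊆ Finset.range N) :
    ofCoeffs a = partialSum (fun n => a n) N := by
  funext z
  rw [ofCoeffs_apply]
  show _ = ∑ n ∈ Finset.range N, a n * z ^ n
  refine Finset.sum_subset hN fun n _ hn => ?_
  have ha : a n = 0 := by
    by_contra h
    exact hn (Finsupp.mem_support_iff.mpr h)
  rw [ha, zero_mul]

/-! ### The pairing of two polynomials -/

/-- **The pairing of two polynomials**: `⟨Σ_{m<N} aₘ zᵐ, Σ_{m<N} bₘ zᵐ⟩_k = Σ_{m<N} aₘ conj(bₘ) ⟨zᵐ, zᵐ⟩_k`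
(orthogonality of the monomials). -/
theorem pairing_partialSum_partialSum (k : ℕ) (hk : 2 ≤ k) (a b : ℕ → ℂ) (N : ℕ) :
    pairing k (partialSum a N) (partialSum b N) =
      ∑ m ∈ Finset.range N, a m * (starRingEnd ℂ) (b m) * ((monomialNormSq k m : ℝ) : ℂ) := by
  have hbc : ContinuousOn (partialSum b N) (ball 0 1) :=
    (differentiable_partialSum b N).continuous.continuousOn
  have hbi := integrableOn_partialSum k b N
  have e1 : pairing k (partialSum a N) (partialSum b N) =
      matrixCoeff k (partialSum a N) (partialSum b N) 1 := by
    unfold matrixCoeff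
    exact pairing_congr (fun z _ => (act_one k _ z).symm) (fun _ _ => rfl)
  rw [e1, matrixCoeff_partialSum k hk a N _ hbc hbi 1]
  refine Finset.sum_congr rfl fun m hm => ?_
  have e2 : matrixCoeff k (fun w => w ^ m) (partialSum b N) 1 =
      pairing k (fun w => w ^ m) (partialSum b N) := by
    unfold matrixCoeff
    exact pairing_congr (fun z _ => act_one k _ z) (fun _ _ => rfl)
  rw [e2, pairing_conj_symm k (partialSum b N) (fun w => w ^ m),
    pairing_monomial_right k hk (fun n => if n < N then b n else 0) (partialSum b N)
      (fun z _ => hasSum_partialSum b N z) hbi m, if_pos (Finset.mem_range.mp hm), map_mul,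
    Complex.conj_ofReal]
  ring

/-! ### The main identification -/

/-- **The Bergman pairing on the `K`-finite vectors is the invariant form of the abstract module**:
`⟨ofCoeffs a, ofCoeffs b⟩_k = π/(k-1) · form k (D b) (D a)` for all coefficient sequences `a, b`
(`k ≥ 2`; the pairing is linear in the first slot, `form` in the second). -/
theorem pairing_ofCoeffs (k : ℕ) (hk : 2 ≤ k) (a b : ℕ →₀ ℂ) :
    pairing k (ofCoeffs a) (ofCoeffs b) =
      ((π / ((k : ℝ) - 1) : ℝ) : ℂ) * form (k : ℝ) (D k b) (D k a) := by
  set N := (a.support ∪ b.support).sup id + 1 with hN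
  have hsub : ∀ n ∈ a.support ∪ b.support, n < N := fun n hn =>
    Nat.lt_succ_of_le (Finset.le_sup (f := id) hn)
  have ha : a.support ⊆ Finset.range N := fun n hn =>
    Finset.mem_range.mpr (hsub n (Finset.mem_union_left _ hn))
  have hb : b.support ⊆ Finset.range N := fun n hn =>
    Finset.mem_range.mpr (hsub n (Finset.mem_union_right _ hn))
  rw [ofCoeffs_eq_partialSum a ha, ofCoeffs_eq_partialSum b hb,
    pairing_partialSum_partialSum k hk _ _ N,
    form_eq_sum (k : ℝ) (D k b) (D k a) ((support_D_subset k b).trans hb), Finset.mul_sum]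
  refine Finset.sum_congr rfl fun m _ => ?_
  rw [D_apply, D_apply, map_mul]
  have hk1 : ((k : ℝ) - 1) ≠ 0 := by
    have : (2 : ℝ) ≤ k := by exact_mod_cast hk
    intro h
    linarith
  have hπ : (π : ℝ) ≠ 0 := Real.pi_ne_zero
  have e : ((monomialNormSq k m : ℝ) : ℂ) =
      ((π / ((k : ℝ) - 1) : ℝ) : ℂ) *
        (lam k m * (starRingEnd ℂ) (lam k m) * ((normCoeff (k : ℝ) m : ℝ) : ℂ)) := by
    rw [lam_mul_conj_mul_normCoeff k hk m, ← mul_assoc, ← Complex.ofReal_mul,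
      show π / ((k : ℝ) - 1) * (((k : ℝ) - 1) / π) = 1 by field_simp, Complex.ofReal_one, one_mul]
  rw [e]
  ring

/-- The inverse direction: `form k (D b) (D a) = (k-1)/π · ⟨ofCoeffs a, ofCoeffs b⟩_k`. -/
theorem form_D_D (k : ℕ) (hk : 2 ≤ k) (a b : ℕ →₀ ℂ) :
    form (k : ℝ) (D k b) (D k a) =
      ((((k : ℝ) - 1) / π : ℝ) : ℂ) * pairing k (ofCoeffs a) (ofCoeffs b) := by
  rw [pairing_ofCoeffs k hk a b]
  have hk1 : ((k : ℝ) - 1) ≠ 0 := by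
    have : (2 : ℝ) ≤ k := by exact_mod_cast hk
    intro h
    linarith
  have hπ : (π : ℝ) ≠ 0 := Real.pi_ne_zero
  rw [← mul_assoc, ← Complex.ofReal_mul]
  have e : ((k : ℝ) - 1) / π * (π / ((k : ℝ) - 1)) = 1 := by field_simp
  rw [e, Complex.ofReal_one, one_mul]

/-- **On the abstract module**: for `v, w ∈ Model ℂ k`, the invariant form is the Bergman pairing of
the corresponding polynomials: `form k v w = (k-1)/π · ⟨ofCoeffs (Dinv w), ofCoeffs (Dinv v)⟩_k`. -/
theorem form_eq_pairing_ofCoeffs_Dinv (k : ℕ) (hk : 2 ≤ k) (v w : ℕ →₀ ℂ) :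
    form (k : ℝ) v w =
      ((((k : ℝ) - 1) / π : ℝ) : ℂ) * pairing k (ofCoeffs (Dinv k w)) (ofCoeffs (Dinv k v)) := by
  have hk1 : 1 ≤ k := by omega
  have hv := LinearMap.congr_fun (D_Dinv k hk1) v
  have hw := LinearMap.congr_fun (D_Dinv k hk1) w
  simp only [LinearMap.comp_apply, LinearMap.id_apply] at hv hw
  have := form_D_D k hk (Dinv k w) (Dinv k v)
  rwa [hv, hw] at this

/-- The squared norms agree: `⟨ofCoeffs a, ofCoeffs a⟩_k = π/(k-1) · form k (D a) (D a)` (real parts). -/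
theorem pairing_ofCoeffs_self_re (k : ℕ) (hk : 2 ≤ k) (a : ℕ →₀ ℂ) :
    (pairing k (ofCoeffs a) (ofCoeffs a)).re = π / ((k : ℝ) - 1) * (form (k : ℝ) (D k a) (D k a)).re := by
  rw [pairing_ofCoeffs k hk a a, Complex.re_ofReal_mul]

end Summit.Ventures.HodgeRepro2.T5BergmanModelUnitary
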